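import Mathlib
import Summits.Ventures.PercRepro2.HCov
import Summits.Ventures.PercRepro2.BHKOutside

/-!
# The first-order (HCOV) at an infinitesimal pendant root — the four terms and three of their signs
(blind cell PercRepro2, p5 g21; `proofs/P5-OEDGE.md` §27; the fourth sign and the sum in `FirstOrderRoot.lean`)

Attach the root `a₂` to a vertex `z` of a graph `G′` (marks `o, a₁, a₃, b`) by ONE edge of weight
`ε → 0`.  Then `Gc₀ = 0` (the closed pin has `C₂ = {a₂}` and `G ≡ 0` there) and the one-copy
Bernstein coefficient of the root edge (`EdgeCubic.B1`) is `2·Φ` with `Φ` the functional below —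
a statement about free percolation on `G′` alone (`S = C(a₁)`, `K = C(z)`, `W = C(a₃)`;
`β = P(b ↔ a₁)`, `D₀ = P(a₃ ∉ C(a₁))`, `D_o⁰ = P(a₃ ∉ C(a₁), o ∈ C(a₁))`):

  `Φ = D₀·Afo + D₀·Bfo + Cfo + Dfo`,

* `Afo = P(z ∉ S, a₃ ∈ S, b ∈ K, o ∈ K) ≥ 0` (a probability);
* `Bfo = β·P(K ∌ a₁, a₃; o ∈ K) − P(K ∌ a₁, a₃; o ∈ K; b ∈ S) ≥ 0` (**`Bfo_nonneg`**: explore `K`;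
  `P_{G′∖K}(b ↔ a₁) ≤ P_{G′}(b ↔ a₁)` — connection probabilities are monotone in the graph);
* `Cfo = D_o⁰·P(S ∌ z, a₃; b ∈ K) − D₀·P(S ∌ z, a₃; b ∈ K; o ∈ S) ≥ 0` (**`Cfo_nonneg`**: BHK06 Thm 1.4
  in the tree's outside form `bhk_inside_outside_avoid`, `s = a₁`, `t = z`, `X = {a₃}`);
* `Dfo = D₀·P(W ∌ a₁, z ∈ W, b, o ∈ S) − β·D₀·P(W ∌ a₁, z ∈ W, o ∈ S) − D_o⁰·P(W ∌ a₁, z ∈ W, b ∈ S)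
  + β·D_o⁰·P(W ∌ a₁, z ∈ W) ≥ 0` (**`Dfo_nonneg`**: explore `W = C(a₃)` under `a₁ ∉ W`; Harris on
  `G′ ∖ W` for the joint term, then BHK06 Thm 1.1 (`bhk_univ_avoid`) for the increasing functional
  `1_{z ∈ W}·(β − P_{G′∖W}(b ↔ a₁))` against the decreasing `P_{G′∖W}(o ↔ a₁)`, whose mean on
  `{a₁ ∉ W}` is `D_o⁰/D₀`).

This file: the definitions, `Afo_nonneg`, `Bfo_nonneg`, `Cfo_nonneg` and the exploration lemmas for
`Dfo`; `FirstOrderRoot.lean` proves `Dfo_nonneg` and **`Phi_nonneg`**: `0 ≤ Φ`.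
-/

namespace Summit.Ventures.PercRepro2

open UnionCluster

namespace CovForm

namespace FirstOrder

section Defs

variable {V : Type*} {E : Type*} [Fintype E] [DecidableEq E] [DecidableEq V] {R : Type*}
  [Field R] [LinearOrder R]

/-- `β = P(b ↔ a₁)` on the base graph. -/
noncomputable def beta (p : E → R) (ends : E → Sym2 V) (a₁ b : V) : R :=
  prob p (connEvent ends a₁ b)

/-- `D₀ = P(a₃ ∉ C(a₁))`. -/
noncomputable def D0 (p : E → R) (ends : E → Sym2 V) (a₁ a₃ : V) : R :=
  prob p (avoidAll ends a₁ {a₃})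

/-- `D_o⁰ = P(a₃ ∉ C(a₁), o ∈ C(a₁))`. -/
noncomputable def Do0 (p : E → R) (ends : E → Sym2 V) (o a₁ a₃ : V) : R :=
  prob p (avoidAll ends a₁ {a₃} ∩ connEvent ends a₁ o)

/-- `Afo = P(z ∉ C(a₁), a₃ ∈ C(a₁), b ∈ C(z), o ∈ C(z))`. -/
noncomputable def Afo (p : E → R) (ends : E → Sym2 V) (o a₁ a₃ b z : V) : R :=
  prob p (avoidAll ends a₁ {z} ∩ connEvent ends a₁ a₃ ∩ connEvent ends z b ∩ connEvent ends z o)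

/-- `Bfo = β·P(C(z) ∌ a₁, a₃; o ∈ C(z)) − P(C(z) ∌ a₁, a₃; o ∈ C(z); b ∈ C(a₁))`. -/
noncomputable def Bfo (p : E → R) (ends : E → Sym2 V) (o a₁ a₃ b z : V) : R :=
  beta p ends a₁ b * prob p (avoidAll ends z {a₁, a₃} ∩ connEvent ends z o) -
    prob p (avoidAll ends z {a₁, a₃} ∩ connEvent ends z o ∩ connEvent ends a₁ b)

/-- `Cfo = D_o⁰·P(C(a₁) ∌ z, a₃; b ∈ C(z)) − D₀·P(C(a₁) ∌ z, a₃; b ∈ C(z); o ∈ C(a₁))`. -/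
noncomputable def Cfo (p : E → R) (ends : E → Sym2 V) (o a₁ a₃ b z : V) : R :=
  Do0 p ends o a₁ a₃ * prob p (avoidAll ends a₁ {z, a₃} ∩ connEvent ends z b) -
    D0 p ends a₁ a₃ * prob p (avoidAll ends a₁ {z, a₃} ∩ connEvent ends z b ∩ connEvent ends a₁ o)

/-- `Dfo = D₀·P(C(a₃) ∌ a₁, z ∈ C(a₃), b ∈ C(a₁), o ∈ C(a₁)) − β·D₀·P(…, o ∈ C(a₁))
− D_o⁰·P(…, b ∈ C(a₁)) + β·D_o⁰·P(C(a₃) ∌ a₁, z ∈ C(a₃))`. -/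
noncomputable def Dfo (p : E → R) (ends : E → Sym2 V) (o a₁ a₃ b z : V) : R :=
  D0 p ends a₁ a₃ *
      prob p (avoidAll ends a₃ {a₁} ∩ connEvent ends a₃ z ∩ connEvent ends a₁ b ∩
        connEvent ends a₁ o) -
    beta p ends a₁ b * D0 p ends a₁ a₃ *
      prob p (avoidAll ends a₃ {a₁} ∩ connEvent ends a₃ z ∩ connEvent ends a₁ o) -
    Do0 p ends o a₁ a₃ *
      prob p (avoidAll ends a₃ {a₁} ∩ connEvent ends a₃ z ∩ connEvent ends a₁ b) +
    beta p ends a₁ b * Do0 p ends o a₁ a₃ *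
      prob p (avoidAll ends a₃ {a₁} ∩ connEvent ends a₃ z)

/-- **The first-order functional** `Φ = D₀·Afo + D₀·Bfo + Cfo + Dfo` (`= B1/2` at the pendant root
edge `{a₂, z}` with `a₂` isolated at the closed pin). -/
noncomputable def Phi (p : E → R) (ends : E → Sym2 V) (o a₁ a₃ b z : V) : R :=
  D0 p ends a₁ a₃ * Afo p ends o a₁ a₃ b z + D0 p ends a₁ a₃ * Bfo p ends o a₁ a₃ b z +
    Cfo p ends o a₁ a₃ b z + Dfo p ends o a₁ a₃ b z

end Defs

section Tools

variable {V : Type*} {E : Type*} [Fintype E] [DecidableEq E] {R : Type*} [CommRing R]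

omit [Fintype E] [DecidableEq E] in
/-- No edge touches the empty set. -/
lemma delConfig_empty (ends : E → Sym2 V) (ω : Config E) : delConfig ends (∅ : Set V) ω = ω := by
  funext e
  apply delConfig_apply_of_notMem
  rintro ⟨x, hx, -⟩
  exact hx

/-- `g(∅) = P(C_t ∈ 𝓥)`: nothing closed, the plain probability. -/
lemma delClusterProb_empty (p : E → R) (ends : E → Sym2 V) (t : V) (𝓥 : Set (Set V)) :
    delClusterProb p ends t 𝓥 (∅ : Set V) = prob p (clusterInEvent ends t 𝓥) := by
  unfold delClusterProb
  congr 1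
  ext ω
  simp [delConfig_empty, clusterInEvent]

end Tools

section Signs

variable {V : Type*} {E : Type*} [Fintype E] [DecidableEq E] [Fintype V] [DecidableEq V]
  {R : Type*} [Field R] [LinearOrder R] [IsStrictOrderedRing R]

omit [Fintype V] [DecidableEq V] in
/-- `0 ≤ Afo` (a probability). -/
theorem Afo_nonneg (p : E → R) (hp : IsProbVec p) (ends : E → Sym2 V) (o a₁ a₃ b z : V) :
    0 ≤ Afo p ends o a₁ a₃ b z :=
  prob_nonneg hp _

/-- **`Bfo ≥ 0`**: explore `K = C(z)`; on `{a₁ ∉ K}` the conditional probability of `b ↔ a₁` is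
`P_{G′∖K}(b ↔ a₁) ≤ P_{G′}(b ↔ a₁) = β`. -/
theorem Bfo_nonneg (p : E → R) (hp : IsProbVec p) (ends : E → Sym2 V) (o a₁ a₃ b z : V) :
    0 ≤ Bfo p ends o a₁ a₃ b z := by
  classical
  unfold Bfo beta
  have h := prob_clusterIn_outside_inter_avoid_eq_expect p ends z a₁ {a₃} {W | o ∈ W} {W | b ∈ W}
  rw [← connEvent_eq_clusterInEvent ends z o, ← connEvent_eq_clusterInEvent ends a₁ b] at h
  have e1 : avoidAll ends z {a₁, a₃} ∩ connEvent ends z o ∩ connEvent ends a₁ b =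
      connEvent ends z o ∩ connEvent ends a₁ b ∩ avoidAll ends z (insert a₁ {a₃}) := by
    ext ω; simp only [Set.mem_inter_iff]; tauto
  rw [e1, h]
  have hβ0 : 0 ≤ prob p (connEvent ends a₁ b) := prob_nonneg hp _
  -- pointwise: the integrand is at most `β · 1[K ∌ a₁, a₃; o ∈ K]`
  have hpt : ∀ ω, {W : Set V | o ∈ W}.indicator 1 (cluster ends ω z) *
      outsideProb p ends a₁ {W | b ∈ W} (cluster ends ω z) * (avoidAll ends z {a₃}).indicator 1 ω ≤
      prob p (connEvent ends a₁ b) *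
        (avoidAll ends z {a₁, a₃} ∩ connEvent ends z o).indicator 1 ω := by
    intro ω
    have hind : 0 ≤ (avoidAll ends z {a₁, a₃} ∩ connEvent ends z o).indicator (1 : Config E → R) ω :=
      Set.indicator_apply_nonneg fun _ => zero_le_one
    by_cases ha : a₁ ∈ cluster ends ω z
    · rw [outsideProb_apply_of_mem p _ ha]
      simp only [mul_zero, zero_mul]
      exact mul_nonneg hβ0 hind
    · rw [outsideProb_apply_of_notMem p _ ha]
      have hg : delClusterProb p ends a₁ {W | b ∈ W} (cluster ends ω z) ≤
          prob p (connEvent ends a₁ b) := by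
        rw [connEvent_eq_clusterInEvent ends a₁ b, ← delClusterProb_empty p ends a₁]
        exact delClusterProb_anti p hp ends a₁ (isUpperSet_mem_setOf b) (Set.empty_subset _)
      have hg0 : 0 ≤ delClusterProb p ends a₁ {W | b ∈ W} (cluster ends ω z) :=
        delClusterProb_nonneg p hp ends a₁ _ _
      by_cases hmem : ω ∈ avoidAll ends z {a₁, a₃} ∩ connEvent ends z o
      · have ho : cluster ends ω z ∈ {W : Set V | o ∈ W} := by
          have := hmem.2
          simpa [mem_cluster] using this
        have hav : ω ∈ avoidAll ends z {a₃} := by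
          intro x hx
          exact hmem.1 x (Finset.mem_insert_of_mem hx)
        rw [Set.indicator_of_mem hmem, Set.indicator_of_mem ho, Set.indicator_of_mem hav]
        simpa using hg
      · rw [Set.indicator_of_notMem hmem, mul_zero]
        by_cases ho : cluster ends ω z ∈ {W : Set V | o ∈ W}
        · have hav : ω ∉ avoidAll ends z {a₃} := by
            intro hav
            apply hmem
            refine ⟨?_, ?_⟩
            · intro x hx
              rcases Finset.mem_insert.1 hx with rfl | hx'
              · exact ha
              · exact hav x hx'
            · simpa [mem_cluster] using ho
          rw [Set.indicator_of_notMem hav, mul_zero]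
        · rw [Set.indicator_of_notMem ho, zero_mul, zero_mul]
  have := expect_mono hp hpt
  rw [expect_const_mul, ← prob_eq_expect_indicator] at this
  linarith

/-- **`Cfo ≥ 0`**: BHK06 Thm 1.4 (`bhk_inside_outside_avoid`, `s = a₁`, `t = z`, `X = {a₃}`):
`P(o ∈ C(a₁), b ∈ C(z), C(a₁) ∌ z, a₃)·P(C(a₁) ∌ a₃) ≤ P(o ∈ C(a₁), C(a₁) ∌ a₃)·P(b ∈ C(z), C(a₁) ∌ z, a₃)`. -/
theorem Cfo_nonneg (p : E → R) (hp : IsProbVec p) (ends : E → Sym2 V) (o a₁ a₃ b z : V) :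
    0 ≤ Cfo p ends o a₁ a₃ b z := by
  unfold Cfo Do0 D0
  have h := bhk_inside_outside_avoid p hp ends a₁ z {a₃} (isUpperSet_mem_setOf o)
    (isUpperSet_mem_setOf b)
  rw [← connEvent_eq_clusterInEvent ends a₁ o, ← connEvent_eq_clusterInEvent ends z b] at h
  have e1 : connEvent ends a₁ o ∩ connEvent ends z b ∩ avoidAll ends a₁ (insert z {a₃}) =
      avoidAll ends a₁ {z, a₃} ∩ connEvent ends z b ∩ connEvent ends a₁ o := by
    ext ω; simp only [Set.mem_inter_iff]; tauto
  have e2 : connEvent ends a₁ o ∩ avoidAll ends a₁ {a₃} =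
      avoidAll ends a₁ {a₃} ∩ connEvent ends a₁ o := Set.inter_comm _ _
  have e3 : connEvent ends z b ∩ avoidAll ends a₁ (insert z {a₃}) =
      avoidAll ends a₁ {z, a₃} ∩ connEvent ends z b := Set.inter_comm _ _
  rw [e1, e2, e3] at h
  linarith

end Signs

section DTerm

variable {V : Type*} {E : Type*} [Fintype E] [DecidableEq E] [Fintype V] [DecidableEq V]
  {R : Type*} [Field R] [LinearOrder R] [IsStrictOrderedRing R]

omit [Fintype E] [DecidableEq E] [Fintype V] [DecidableEq V] [LinearOrder R] [IsStrictOrderedRing R] in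
/-- `{a₃ ∉ C(a₁)} = {a₁ ∉ C(a₃)}`. -/
lemma avoidAll_singleton_comm (ends : E → Sym2 V) (a₁ a₃ : V) :
    avoidAll ends a₁ {a₃} = avoidAll ends a₃ {a₁} := by
  ext ω
  simp only [mem_avoidAll, Finset.mem_singleton, forall_eq]
  exact ⟨fun h h' => h (conn_symm h'), fun h h' => h (conn_symm h')⟩

omit [Fintype E] [DecidableEq E] [Fintype V] [LinearOrder R] [IsStrictOrderedRing R] in
/-- `insert a₁ {a₁} = {a₁}` for the avoidance set. -/
lemma avoidAll_insert_self (ends : E → Sym2 V) (s a : V) :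
    avoidAll ends s (insert a {a}) = avoidAll ends s {a} := by
  rw [Finset.insert_eq_of_mem (Finset.mem_singleton_self a)]

omit [Fintype V] [DecidableEq V] [LinearOrder R] [IsStrictOrderedRing R] in
/-- On `{a₁ ∉ C(a₃)}` the outside probability is the deleted-cluster probability; off it both
vanish with the indicator. -/
lemma outsideProb_mul_indicator_eq (p : E → R) (ends : E → Sym2 V) (a₁ a₃ : V) (𝓥 : Set (Set V))
    (ω : Config E) :
    outsideProb p ends a₁ 𝓥 (cluster ends ω a₃) * (avoidAll ends a₃ {a₁}).indicator 1 ω =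
      delClusterProb p ends a₁ 𝓥 (cluster ends ω a₃) * (avoidAll ends a₃ {a₁}).indicator 1 ω := by
  by_cases hR : ω ∈ avoidAll ends a₃ {a₁}
  · have ha : a₁ ∉ cluster ends ω a₃ := notMem_cluster_of_mem_avoidAll (Finset.mem_singleton_self a₁) hR
    rw [outsideProb_apply_of_notMem p 𝓥 ha]
  · rw [Set.indicator_of_notMem hR, mul_zero, mul_zero]

omit [LinearOrder R] [IsStrictOrderedRing R] in
/-- The joint mass `P(z ∈ C(a₃), C(a₁) ∈ 𝓥, a₁ ∉ C(a₃))` as an expectation over `C(a₃)`. -/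
lemma mass_eq_expect (p : E → R) (ends : E → Sym2 V) (a₁ a₃ z : V) (𝓥 : Set (Set V)) :
    prob p (clusterInEvent ends a₃ {W | z ∈ W} ∩ clusterInEvent ends a₁ 𝓥 ∩
        avoidAll ends a₃ {a₁}) =
      expect p (fun ω => {W : Set V | z ∈ W}.indicator 1 (cluster ends ω a₃) *
        delClusterProb p ends a₁ 𝓥 (cluster ends ω a₃) * (avoidAll ends a₃ {a₁}).indicator 1 ω) := by
  have h := prob_clusterIn_outside_inter_avoid_eq_expect p ends a₃ a₁ {a₁} {W | z ∈ W} 𝓥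
  rw [avoidAll_insert_self] at h
  rw [h]
  refine congrArg (expect p) (funext fun ω => ?_)
  rw [mul_assoc, outsideProb_mul_indicator_eq, mul_assoc]

omit [LinearOrder R] [IsStrictOrderedRing R] in
/-- The marginal mass `P(C(a₁) ∈ 𝓥, a₁ ∉ C(a₃))` as an expectation over `C(a₃)`. -/
lemma mass_eq_expect' (p : E → R) (ends : E → Sym2 V) (a₁ a₃ : V) (𝓥 : Set (Set V)) :
    prob p (clusterInEvent ends a₁ 𝓥 ∩ avoidAll ends a₃ {a₁}) =
      expect p (fun ω => delClusterProb p ends a₁ 𝓥 (cluster ends ω a₃) *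
        (avoidAll ends a₃ {a₁}).indicator 1 ω) := by
  have h := prob_outside_inter_avoid_eq_expect p ends a₃ a₁ {a₁} 𝓥
  rw [avoidAll_insert_self] at h
  rw [h]
  exact congrArg (expect p) (funext fun ω => outsideProb_mul_indicator_eq p ends a₁ a₃ 𝓥 ω)

omit [Fintype V] [DecidableEq V] [LinearOrder R] [IsStrictOrderedRing R] in
/-- `P(z ∈ C(a₃), a₁ ∉ C(a₃))` as an expectation. -/
lemma mass_eq_expect'' (p : E → R) (ends : E → Sym2 V) (a₁ a₃ z : V) :
    prob p (clusterInEvent ends a₃ {W | z ∈ W} ∩ avoidAll ends a₃ {a₁}) =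
      expect p (fun ω => {W : Set V | z ∈ W}.indicator 1 (cluster ends ω a₃) *
        (avoidAll ends a₃ {a₁}).indicator 1 ω) := by
  rw [prob_eq_expect_indicator]
  refine congrArg (expect p) (funext fun ω => ?_)
  by_cases h1 : ω ∈ clusterInEvent ends a₃ {W | z ∈ W}
  · by_cases h2 : ω ∈ avoidAll ends a₃ {a₁}
    · rw [Set.indicator_of_mem (Set.mem_inter h1 h2), Set.indicator_of_mem h2,
        Set.indicator_of_mem (mem_clusterInEvent.1 h1)]
      simp
    · rw [Set.indicator_of_notMem (fun h => h2 (Set.mem_of_mem_inter_right h)),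
        Set.indicator_of_notMem h2, mul_zero]
  · rw [Set.indicator_of_notMem (fun h => h1 (Set.mem_of_mem_inter_left h)),
      Set.indicator_of_notMem (fun h => h1 (mem_clusterInEvent.2 h)), zero_mul]

omit [Fintype V] [DecidableEq V] in
/-- Harris on `G′ ∖ W`, for the two events `b ∈ C(a₁)`, `o ∈ C(a₁)`. -/
lemma delClusterProb_mul_le_inter (p : E → R) (hp : IsProbVec p) (ends : E → Sym2 V) (a₁ b o : V)
    (W : Set V) :
    delClusterProb p ends a₁ {W | b ∈ W} W * delClusterProb p ends a₁ {W | o ∈ W} W ≤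
      delClusterProb p ends a₁ {W | b ∈ W ∧ o ∈ W} W := by
  have h := delClusterProb_mul_le hp ends a₁ a₁ (isUpperSet_mem_setOf b) (isUpperSet_mem_setOf o) W
  unfold delClusterProb
  exact h

omit [Fintype V] [DecidableEq V] in
/-- `g_b(W) ≤ β = P(b ↔ a₁)`. -/
lemma delClusterProb_le_beta (p : E → R) (hp : IsProbVec p) (ends : E → Sym2 V) (a₁ b : V)
    (W : Set V) :
    delClusterProb p ends a₁ {W | b ∈ W} W ≤ beta p ends a₁ b := by
  unfold beta
  rw [connEvent_eq_clusterInEvent ends a₁ b, ← delClusterProb_empty p ends a₁]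
  exact delClusterProb_anti p hp ends a₁ (isUpperSet_mem_setOf b) (Set.empty_subset _)

end DTerm

end FirstOrder

end CovForm

end Summit.Ventures.PercRepro2
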